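import Literature.MathematicalPhysics.QuantumFieldTheory.QCDTransferMatrix
import Literature.MathematicalPhysics.QuantumLattice.GaugeGroups

/-!
# Dictionary: Smit's slice mass-plus-hop matrix `A(U)` on a time slice of a four-torus field
(crux `QuarksAsStableAction.StableActionBridge`, item stmt-QuantumFields-9737, line `Sketch`;
registered stub `sliceMassHop_timeSlice_apply` of the lead skeleton)

Two formalised forms of the same spin-blind one-slice Wilson matrix are identified entrywise.

* Smit's vocabulary (`QCDTransferMatrix.lean`): for a THREE-dimensional slice configuration
  `V : GaugeConfig 3 S SU(3)` and masses `mq : Fin Nf → ℝ`,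
  `sliceMassHop V mq = diag(mq f + 4) − ½ ∑ⱼ (colourHop V j + (colourHop V j)ᴴ)` on the index
  `Fin Nf × (TorusSite 3 S × Fin 3)`, with the forward colour hop
  `(colourHop V j)_{(f,x,a),(f',y,b)} = δ_{ff'} δ_{y,x+ĵ} V(x,j)_{ab}`.
* The explicit slice block of the Wilson fermion determinant of a four-torus gauge field `U`
  (theorem `wilson_det_transfer_form`): at Euclidean time `t`, the matrix with entries
  `δ_{ab}(m + 4) − ½ ∑ⱼ (δ_{b.1, a.1+ĵ} ρ(U((t, a.1), ĵ))_{a.2 b.2}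
    + δ_{a.1, b.1+ĵ} ρ(U((t, b.1), ĵ))⁻¹_{a.2 b.2})`,
  `ρ = fundamentalRep (Fin 3)`, spatial direction `j : Fin 3` of the three-torus being the
  four-torus direction `j.succ` (time is coordinate `0`).

`sliceMassHop_timeSlice_apply`: for one flavour (`Nf = 1`, flavour index `0 : Fin 1`) and the
slice configuration `e ↦ U (Fin.cons t e.1, e.2.succ)` of `U` at time `t`, the two agree
entrywise.  The only non-definitional point is the backward hop: the conjugate-transpose entry
`((colourHop V j)ᴴ)_{pq} = star (V(y,j)_{b a})` is the entry of the group inverse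
`V(y,j)⁻¹ = V(y,j)ᴴ` in `SU(3)` (Mathlib's `Matrix.star_eq_inv`, definitional).

[cite: Smit2023, §6.5 (6.74)]
-/

noncomputable section

open MeasureTheory Matrix Literature.MathematicalPhysics.QuantumFieldTheory
  Literature.MathematicalPhysics.QuantumLattice
open Literature.Probability.LatticeModels (TorusSite)

namespace Summit.QuantumFields.QCD.Cruxes.StableActionBridge.Sketch

/-- **Dictionary `sliceMassHop` ↔ explicit slice block.**  For a four-torus `SU(3)` gauge field
`U`, one flavour of bare mass `m` and a time `t`, the entry `((0, a), (0, b))` of Smit's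
`A(U_t) = diag(m + 4) − ½∑ⱼ(W_j + W_jᴴ)` of the slice configuration `U_t : e ↦ U((t, e.1), e.2.succ)`
is `δ_{ab}(m + 4) − ½ ∑ⱼ (δ_{b.1, a.1+ĵ} ρ(U((t,a.1), ĵ))_{a.2 b.2} + δ_{a.1, b.1+ĵ} ρ(U((t,b.1), ĵ))⁻¹_{a.2 b.2})`,
`ρ` the fundamental representation (the backward hop uses `V⁻¹ = Vᴴ` in `SU(3)`).
[cite: Smit2023, §6.5 (6.74)] -/
theorem sliceMassHop_timeSlice_apply : ∀ (L : ℕ) [NeZero L] (U : GaugeConfig 4 L (Matrix.specialUnitaryGroup (Fin 3) ℂ)) (m : ℝ) (t : ZMod L) (a b : TorusSite 3 L × Fin 3), sliceMassHop (fun e : Edge 3 L => U ((Fin.cons t e.1 : TorusSite 4 L), e.2.succ)) (fun _ : Fin 1 => m) (0, a) (0, b) = (if a = b then ((m + 4 : ℝ) : ℂ) else 0) - (1 / 2 : ℂ) * ∑ j : Fin 3, ((if b.1 = Literature.MathematicalPhysics.QuantumFieldTheory.Site.shift a.1 j then fundamentalRep (Fin 3) (U ((Fin.cons t a.1 : TorusSite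 4 L), j.succ)) a.2 b.2 else 0) + (if a.1 = Literature.MathematicalPhysics.QuantumFieldTheory.Site.shift b.1 j then fundamentalRep (Fin 3) (U ((Fin.cons t b.1 : TorusSite 4 L), j.succ))⁻¹ a.2 b.2 else 0)) := by
  intro L _ U m t a b
  unfold sliceMassHop colourHop
  simp only [Matrix.sub_apply, Matrix.diagonal_apply, Matrix.smul_apply, Matrix.sum_apply,
    Matrix.add_apply, Matrix.of_apply, Matrix.conjTranspose_apply, smul_eq_mul, Prod.mk.injEq,
    true_and, fundamentalRep_apply]
  congr 1
  congr 1
  refine Finset.sum_congr rfl fun j _ => ?_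
  congr 1
  split_ifs
  · -- backward hop: `star (V b.2 a.2) = (V⁻¹) a.2 b.2`, definitional in `specialUnitaryGroup`
    rfl
  · exact star_zero ℂ

end Summit.QuantumFields.QCD.Cruxes.StableActionBridge.Sketch

end
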